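import Summits.NavierStokesRegularity.NavierStokesRegularity.Theorems.TerminalTraceTypeITraceScarL3SqrtTwoApexCutoffCalculus
import Literature.Analysis.FluidPDE.WholeSpaceIBPEnstrophy
import HarnessLib

/-!
# The slice identities of ROUND-27 «THE √2 APEX» (T27-A′, steps (i)–(ii)): energy and enstrophy
# pairings of the cut-off velocity against the Navier–Stokes time derivative, reduced to SHELL terms
# (item `TerminalTrace.TypeITraceScarL3`, stmt-NavierStokesRegularity-18385, Stub LOUD line; helpers)

Seat nsreg-C26-p1 g2 (cell ns-regularity-ideate), `--supports stmt-NavierStokesRegularity-18385` (helper);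
planner-of-record nsreg-p2 g29 (ROUND-27 §1 (i)–(ii)).  ONE TIME SLICE: smooth fields `V, Vt : ℝ³ → ℝ³` and a
smooth scalar `q` with the unit-viscosity momentum equation `Vt + (V·∇)V = ΔV − ∇q` and `div V = 0`, a smooth
compactly supported cut-off `φ`, and `w = φV`.  Every pressure term and every commutator is a SHELL term: it
involves only `Δw − φΔV`, `∂_V φ`, `∂_V φ²` (which vanish where `φ` is locally constant) or a pairing
`∫ q · div(Ψ)` with `Ψ` compactly supported.

* `integral_inner_cutoff_timeDeriv_add_enstrophy_eq` — **the energy identity**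
  `∫⟪w, φVt⟫ + ∫|∇w|²_F = −∫⟪w, Δw − φΔV⟫ + ½∫ (∂_Vφ²)‖V‖² + ∫ q ∂_Vφ²`
  (`∫⟪w,Δw⟫ = −∫|∇w|²_F`; exact drift cancellation `2∫φ²⟪(V·∇)V, V⟫ = −∫(∂_Vφ²)‖V‖²`; the pressure
  `∫⟪∇q, φ²V⟫ = −∫ q div(φ²V) = −∫ q ∂_Vφ²` since `div V = 0`).
* `integral_inner_laplacian_cutoff_timeDeriv_eq` — **the enstrophy pairing**
  `∫⟪Δw, φVt⟫ = ∫‖Δw‖² − ∫⟪Δw, Δw − φΔV⟫ − ∫⟪Δw, (V·∇)w⟫ + ∫⟪Δw, (∂_Vφ)V⟫ + ∫ q div(φΔw)`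
  (`φ(V·∇)V = (V·∇)w − (∂_Vφ)V`; `∫⟪∇q, φΔw⟫ = −∫ q div(φΔw)`).
With `E' = 2∫⟪w, φVt⟫` and `D' = −2∫⟪Δw, φVt⟫` (`…SqrtTwoApexCutoffCalculus`) these are the identities
`E' = −2D + 2S₁`, `D' = −2Q₀ + 2X − 2S₂` of T27-A′ with the shell sources `S₁, S₂` displayed.

WHAT THIS IS NOT: not T27-A′ (no bounds yet), not T27-A, not NS regularity.  [folklore; Ghidaglia 1986; Temam
IDDS 1997 §III.6; Kukavica 2007 (5)]
-/

noncomputable section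

set_option linter.dupNamespace false

namespace Summit.NavierStokesRegularity.NavierStokesRegularity.Theorems.TypeITraceScarL3

open MeasureTheory Set Function Filter Topology Metric InnerProductSpace
open Literature.Analysis.FluidPDE
open scoped RealInnerProductSpace Laplacian ContDiff

variable {V Vt : EuclideanSpace ℝ (Fin 3) → EuclideanSpace ℝ (Fin 3)} {q φ : EuclideanSpace ℝ (Fin 3) → ℝ}

/-- Continuous integrands carrying a factor supported in `tsupport φ` are integrable (helper). -/
private theorem integrable_of_continuous_of_tsupport {f : EuclideanSpace ℝ (Fin 3) → ℝ}
    (hf : Continuous f) (hφc : HasCompactSupport φ) (h0 : ∀ y ∉ tsupport φ, f y = 0) :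
    Integrable f (volume : Measure (EuclideanSpace ℝ (Fin 3))) :=
  hf.integrable_of_hasCompactSupport (HasCompactSupport.intro hφc h0)

/-- The pressure pairing against a cut-off field: `∫ ⟪∇q, φW⟫ = −∫ q div(φW)` for `W ∈ C¹_c`
(tree `integral_inner_gradient_eq_neg_integral_mul_divergence`). [folklore] -/
theorem integral_inner_gradient_cutoff_eq {W : EuclideanSpace ℝ (Fin 3) → EuclideanSpace ℝ (Fin 3)}
    (hq1 : ContDiff ℝ 1 q) (hφ1 : ContDiff ℝ 1 φ) (hW1 : ContDiff ℝ 1 W) (hWs : HasCompactSupport W) :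
    ∫ y, ⟪gradient q y, φ y • W y⟫ = -∫ y, q y * VectorCalculus.divergence (fun y => φ y • W y) y := by
  have hψ : ContDiff ℝ 1 (fun y => φ y • W y) := hφ1.smul hW1
  have hψc : HasCompactSupport (fun y => φ y • W y) :=
    HasCompactSupport.intro hWs fun y hy => by rw [image_eq_zero_of_notMem_tsupport hy, smul_zero]
  exact integral_inner_gradient_eq_neg_integral_mul_divergence hq1 hψ hψc

/-- **The energy identity on a slice** (module docstring): for smooth `V, Vt, q` with
`Vt + (V·∇)V = ΔV − ∇q`, `div V = 0`, and a smooth compactly supported `φ`, with `w = φV`: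
`∫⟪w, φVt⟫ + ∫|∇w|²_F = −∫⟪w, Δw − φΔV⟫ + ½∫ (∂_Vφ²)‖V‖² + ∫ q ∂_Vφ²`. [folklore; Temam IDDS §III.6] -/
theorem integral_inner_cutoff_timeDeriv_add_enstrophy_eq
    (hV : ContDiff ℝ ∞ V) (hVt : ContDiff ℝ ∞ Vt) (hq : ContDiff ℝ ∞ q)
    (hmom : ∀ y, Vt y + convect V V y = (Δ V) y - gradient q y)
    (hdiv : VectorCalculus.IsDivFree V) (hφ : ContDiff ℝ ∞ φ) (hφc : HasCompactSupport φ) :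
    (∫ y, ⟪φ y • V y, φ y • Vt y⟫) + ∫ y, frobeniusNormSq (fderiv ℝ (fun y => φ y • V y) y) =
      -(∫ y, ⟪φ y • V y, (Δ (fun y => φ y • V y)) y - φ y • (Δ V) y⟫) +
        (1 / 2) * (∫ y, fderiv ℝ (fun y => φ y ^ 2) y (V y) * ‖V y‖ ^ 2) +
        ∫ y, q y * fderiv ℝ (fun y => φ y ^ 2) y (V y) := by
  -- smoothness bookkeeping
  have hw : ContDiff ℝ ∞ (fun y => φ y • V y) := hφ.smul hV
  have hwc : HasCompactSupport (fun y => φ y • V y) := hφc.smul_right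
  have hV2 : ContDiff ℝ 2 V := hV.of_le (by norm_cast)
  have hw2 : ContDiff ℝ 2 (fun y => φ y • V y) := hw.of_le (by norm_cast)
  have hφ2 : ContDiff ℝ ∞ (fun y => φ y ^ 2) := hφ.pow 2
  have hφ2c : HasCompactSupport (fun y => φ y ^ 2) :=
    HasCompactSupport.intro hφc fun y hy => by simp [image_eq_zero_of_notMem_tsupport hy]
  have hφ1 : ContDiff ℝ 1 φ := hφ.of_le (by norm_cast)
  have hφ21 : ContDiff ℝ 1 (fun y => φ y ^ 2) := hφ2.of_le (by norm_cast)
  have hq1 : ContDiff ℝ 1 q := hq.of_le (by norm_cast)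
  have hcV : Continuous V := hV.continuous
  have hcΔV : Continuous (Δ V) := continuous_laplacian hV2
  have hcΔw : Continuous (Δ (fun y => φ y • V y)) := continuous_laplacian hw2
  have hcφ : Continuous φ := hφ.continuous
  have hcVt : Continuous Vt := hVt.continuous
  have hcconv : Continuous (convect V V) := by
    have : convect V V = fun y => fderiv ℝ V y (V y) := rfl
    rw [this]; exact ((hV.of_le (by norm_cast : (1 : WithTop ℕ∞) ≤ ∞)).continuous_fderiv
      one_ne_zero).clm_apply hcV
  have hcgq : Continuous (gradient q) := continuous_gradient_of_contDiff hq1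
  have hφ0 : ∀ y ∉ tsupport φ, φ y = 0 := fun y hy => image_eq_zero_of_notMem_tsupport hy
  -- the momentum equation, tested against `φ² V = φ w`
  have hsplit : ∀ y, ⟪φ y • V y, φ y • Vt y⟫ =
      ⟪φ y • V y, φ y • (Δ V) y⟫ - φ y ^ 2 * ⟪convect V V y, V y⟫ - ⟪gradient q y, φ y ^ 2 • V y⟫ := by
    intro y
    have e : Vt y = (Δ V) y - convect V V y - gradient q y := by
      rw [eq_sub_of_add_eq (hmom y)]; abel
    rw [e]
    simp only [smul_sub, inner_sub_right, real_inner_smul_left, real_inner_smul_right]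
    rw [real_inner_comm (V y) (convect V V y), real_inner_comm (V y) (gradient q y)]
    ring
  -- integrability of the three pieces
  have i1 : Integrable (fun y => ⟪φ y • V y, φ y • (Δ V) y⟫) (volume : Measure (EuclideanSpace ℝ (Fin 3))) :=
    integrable_of_continuous_of_tsupport ((hcφ.smul hcV).inner (hcφ.smul hcΔV)) hφc
      fun y hy => by simp [hφ0 y hy]
  have i2 : Integrable (fun y => φ y ^ 2 * ⟪convect V V y, V y⟫) (volume : Measure (EuclideanSpace ℝ (Fin 3))) :=
    integrable_of_continuous_of_tsupport ((hcφ.pow 2).mul (hcconv.inner hcV)) hφc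
      fun y hy => by simp [hφ0 y hy]
  have i3 : Integrable (fun y => ⟪gradient q y, φ y ^ 2 • V y⟫) (volume : Measure (EuclideanSpace ℝ (Fin 3))) :=
    integrable_of_continuous_of_tsupport (hcgq.inner ((hcφ.pow 2).smul hcV)) hφc
      fun y hy => by simp [hφ0 y hy]
  have hL : ∫ y, ⟪φ y • V y, φ y • Vt y⟫ =
      (∫ y, ⟪φ y • V y, φ y • (Δ V) y⟫) - (∫ y, φ y ^ 2 * ⟪convect V V y, V y⟫) -
        ∫ y, ⟪gradient q y, φ y ^ 2 • V y⟫ := by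
    have i12 : Integrable (fun y => ⟪φ y • V y, φ y • (Δ V) y⟫ - φ y ^ 2 * ⟪convect V V y, V y⟫)
        (volume : Measure (EuclideanSpace ℝ (Fin 3))) := i1.sub i2
    rw [integral_congr_ae (Eventually.of_forall hsplit), integral_sub i12 i3, integral_sub i1 i2]
  -- (a) the viscous term against `Δw`
  have i4 : Integrable (fun y => ⟪φ y • V y, (Δ (fun y => φ y • V y)) y⟫)
      (volume : Measure (EuclideanSpace ℝ (Fin 3))) :=
    integrable_of_continuous_of_tsupport ((hcφ.smul hcV).inner hcΔw) hφc fun y hy => by simp [hφ0 y hy]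
  have ha : ∫ y, ⟪φ y • V y, φ y • (Δ V) y⟫ =
      (∫ y, ⟪φ y • V y, (Δ (fun y => φ y • V y)) y⟫) -
        ∫ y, ⟪φ y • V y, (Δ (fun y => φ y • V y)) y - φ y • (Δ V) y⟫ := by
    have i41 : Integrable (fun y => ⟪φ y • V y, (Δ (fun y => φ y • V y)) y - φ y • (Δ V) y⟫)
        (volume : Measure (EuclideanSpace ℝ (Fin 3))) := by
      refine (i4.sub i1).congr (Eventually.of_forall fun y => ?_)
      simp only [Pi.sub_apply, inner_sub_right]
    rw [← integral_sub i4 i41]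
    refine integral_congr_ae (Eventually.of_forall fun y => ?_)
    simp only [inner_sub_right]; ring
  have hGreen : ∫ y, ⟪φ y • V y, (Δ (fun y => φ y • V y)) y⟫ =
      -∫ y, frobeniusNormSq (fderiv ℝ (fun y => φ y • V y) y) := by
    rw [integral_frobeniusNormSq_fderiv_eq_neg_integral_inner_laplacian hw hwc, neg_neg]
    exact integral_congr_ae (Eventually.of_forall fun y => real_inner_comm _ _)
  -- (b) the drift: exact cancellation with the weight `φ²`
  have hb : 2 * (∫ y, φ y ^ 2 * ⟪convect V V y, V y⟫) =
      -(∫ y, fderiv ℝ (fun y => φ y ^ 2) y (V y) * ‖V y‖ ^ 2) :=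
    two_mul_integral_mul_inner_convect_self_eq_of_isDivFree hφ2 hφ2c hV hV hdiv
  -- (c) the pressure: `∫⟪∇q, φ²V⟫ = −∫ q div(φ²V) = −∫ q ∂_V φ²`
  have hc : ∫ y, ⟪gradient q y, φ y ^ 2 • V y⟫ = -∫ y, q y * fderiv ℝ (fun y => φ y ^ 2) y (V y) := by
    rw [integral_inner_gradient_eq_neg_integral_mul_divergence (ψ := fun y => φ y ^ 2 • V y) hq1
      (hφ21.smul (hV.of_le (by norm_cast))) hφ2c.smul_right]
    congr 1
    refine integral_congr_ae (Eventually.of_forall fun y => ?_)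
    dsimp only
    rw [divergence_smul_apply (hφ21.differentiable one_ne_zero y) (hV.differentiable (by simp) y), hdiv y,
      mul_zero, zero_add, real_inner_comm, gradient, InnerProductSpace.toDual_symm_apply]
  rw [hL, ha, hGreen, hc]
  linarith [hb]

/-- **The enstrophy pairing on a slice** (module docstring): under the same hypotheses,
`∫⟪Δw, φVt⟫ = ∫‖Δw‖² − ∫⟪Δw, Δw − φΔV⟫ − ∫⟪Δw, (V·∇)w⟫ + ∫⟪Δw, (∂_Vφ)V⟫ + ∫ q div(φΔw)`.
[folklore; Ghidaglia 1986; Kukavica 2007 (5)] -/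
theorem integral_inner_laplacian_cutoff_timeDeriv_eq
    (hV : ContDiff ℝ ∞ V) (hVt : ContDiff ℝ ∞ Vt) (hq : ContDiff ℝ ∞ q)
    (hmom : ∀ y, Vt y + convect V V y = (Δ V) y - gradient q y)
    (hφ : ContDiff ℝ ∞ φ) (hφc : HasCompactSupport φ) :
    ∫ y, ⟪(Δ (fun y => φ y • V y)) y, φ y • Vt y⟫ =
      (∫ y, ‖(Δ (fun y => φ y • V y)) y‖ ^ 2) -
        (∫ y, ⟪(Δ (fun y => φ y • V y)) y, (Δ (fun y => φ y • V y)) y - φ y • (Δ V) y⟫) -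
        (∫ y, ⟪(Δ (fun y => φ y • V y)) y, convect V (fun y => φ y • V y) y⟫) +
        (∫ y, ⟪(Δ (fun y => φ y • V y)) y, (fderiv ℝ φ y (V y)) • V y⟫) +
        ∫ y, q y * VectorCalculus.divergence (fun y => φ y • (Δ (fun y => φ y • V y)) y) y := by
  have hw : ContDiff ℝ ∞ (fun y => φ y • V y) := hφ.smul hV
  have hwc : HasCompactSupport (fun y => φ y • V y) := hφc.smul_right
  have hV2 : ContDiff ℝ 2 V := hV.of_le (by norm_cast)
  have hw2 : ContDiff ℝ 2 (fun y => φ y • V y) := hw.of_le (by norm_cast)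
  have hq1 : ContDiff ℝ 1 q := hq.of_le (by norm_cast)
  have hcV : Continuous V := hV.continuous
  have hcΔV : Continuous (Δ V) := continuous_laplacian hV2
  have hΔw : ContDiff ℝ ∞ (Δ (fun y => φ y • V y)) :=
    contDiff_infty.2 fun n => contDiff_laplacian (n := n) (contDiff_infty.1 hw (n + 2))
  have hΔw1 : ContDiff ℝ 1 (Δ (fun y => φ y • V y)) := hΔw.of_le (by norm_cast)
  have hcΔw : Continuous (Δ (fun y => φ y • V y)) := continuous_laplacian hw2
  have hΔws : HasCompactSupport (Δ (fun y => φ y • V y)) :=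
    HasCompactSupport.intro hwc fun y hy => laplacian_eq_zero_of_notMem_tsupport hy
  have hcφ : Continuous φ := hφ.continuous
  have hcVt : Continuous Vt := hVt.continuous
  have hcconv : Continuous (convect V V) := by
    have : convect V V = fun y => fderiv ℝ V y (V y) := rfl
    rw [this]; exact ((hV.of_le (by norm_cast : (1 : WithTop ℕ∞) ≤ ∞)).continuous_fderiv
      one_ne_zero).clm_apply hcV
  have hcconvw : Continuous (convect V (fun y => φ y • V y)) := by
    have : convect V (fun y => φ y • V y) = fun y => fderiv ℝ (fun y => φ y • V y) y (V y) := rfl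
    rw [this]; exact ((hw.of_le (by norm_cast : (1 : WithTop ℕ∞) ≤ ∞)).continuous_fderiv
      one_ne_zero).clm_apply hcV
  have hcgq : Continuous (gradient q) := continuous_gradient_of_contDiff hq1
  have hcdφ : Continuous (fun y => fderiv ℝ φ y (V y)) :=
    ((hφ.of_le (by norm_cast : (1 : WithTop ℕ∞) ≤ ∞)).continuous_fderiv one_ne_zero).clm_apply hcV
  have hΔ0 : ∀ y ∉ tsupport (fun y => φ y • V y), (Δ (fun y => φ y • V y)) y = 0 :=
    fun y hy => laplacian_eq_zero_of_notMem_tsupport hy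
  -- integrability helper: anything continuous times `Δw`
  have hint : ∀ {g : EuclideanSpace ℝ (Fin 3) → EuclideanSpace ℝ (Fin 3)}, Continuous g →
      Integrable (fun y => ⟪(Δ (fun y => φ y • V y)) y, g y⟫) (volume : Measure (EuclideanSpace ℝ (Fin 3))) :=
    fun hg => (hcΔw.inner hg).integrable_of_hasCompactSupport
      (HasCompactSupport.intro hΔws fun y hy => by
        rw [image_eq_zero_of_notMem_tsupport hy, inner_zero_left])
  -- the momentum equation: `φVt = φΔV − φ(V·∇)V − φ∇q`, and `φ(V·∇)V = (V·∇)w − (∂_Vφ)V`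
  have hsplit : ∀ y, ⟪(Δ (fun y => φ y • V y)) y, φ y • Vt y⟫ =
      ⟪(Δ (fun y => φ y • V y)) y, φ y • (Δ V) y⟫ -
        (⟪(Δ (fun y => φ y • V y)) y, convect V (fun y => φ y • V y) y⟫ -
          ⟪(Δ (fun y => φ y • V y)) y, (fderiv ℝ φ y (V y)) • V y⟫) -
        ⟪gradient q y, φ y • (Δ (fun y => φ y • V y)) y⟫ := by
    intro y
    have e : Vt y = (Δ V) y - convect V V y - gradient q y := by
      rw [eq_sub_of_add_eq (hmom y)]; abel
    have e2 : φ y • convect V V y = convect V (fun y => φ y • V y) y - (fderiv ℝ φ y (V y)) • V y := by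
      rw [convect_smul_apply (hφ.differentiable (by simp) y) (hV.differentiable (by simp) y)]
      abel
    rw [e, smul_sub, smul_sub, e2, inner_sub_right, inner_sub_right, inner_sub_right,
      real_inner_smul_right (Δ (fun y => φ y • V y) y) (gradient q y), real_inner_smul_right (gradient q y),
      real_inner_comm (Δ (fun y => φ y • V y) y) (gradient q y)]
  have hc1 : Continuous (fun y => φ y • (Δ V) y) := hcφ.smul hcΔV
  have hc3 : Continuous (fun y => (fderiv ℝ φ y (V y)) • V y) := hcdφ.smul hcV
  have i1 := hint hc1
  have i2 := hint hcconvw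
  have i3 := hint hc3
  have i4 : Integrable (fun y => ⟪gradient q y, φ y • (Δ (fun y => φ y • V y)) y⟫)
      (volume : Measure (EuclideanSpace ℝ (Fin 3))) :=
    (hcgq.inner (hcφ.smul hcΔw)).integrable_of_hasCompactSupport
      (HasCompactSupport.intro hΔws fun y hy => by
        rw [image_eq_zero_of_notMem_tsupport hy, smul_zero, inner_zero_right])
  have hL : ∫ y, ⟪(Δ (fun y => φ y • V y)) y, φ y • Vt y⟫ =
      (∫ y, ⟪(Δ (fun y => φ y • V y)) y, φ y • (Δ V) y⟫) -
        ((∫ y, ⟪(Δ (fun y => φ y • V y)) y, convect V (fun y => φ y • V y) y⟫) -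
          ∫ y, ⟪(Δ (fun y => φ y • V y)) y, (fderiv ℝ φ y (V y)) • V y⟫) -
        ∫ y, ⟪gradient q y, φ y • (Δ (fun y => φ y • V y)) y⟫ := by
    have i23 : Integrable (fun y => ⟪(Δ (fun y => φ y • V y)) y, convect V (fun y => φ y • V y) y⟫ -
        ⟪(Δ (fun y => φ y • V y)) y, (fderiv ℝ φ y (V y)) • V y⟫)
        (volume : Measure (EuclideanSpace ℝ (Fin 3))) := i2.sub i3
    have i123 : Integrable (fun y => ⟪(Δ (fun y => φ y • V y)) y, φ y • (Δ V) y⟫ -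
        (⟪(Δ (fun y => φ y • V y)) y, convect V (fun y => φ y • V y) y⟫ -
          ⟪(Δ (fun y => φ y • V y)) y, (fderiv ℝ φ y (V y)) • V y⟫))
        (volume : Measure (EuclideanSpace ℝ (Fin 3))) := i1.sub i23
    rw [integral_congr_ae (Eventually.of_forall hsplit), integral_sub i123 i4,
      integral_sub i1 i23, integral_sub i2 i3]
  -- (a') the viscous term against `Δw`
  have i5 := hint hcΔw
  have ha : ∫ y, ⟪(Δ (fun y => φ y • V y)) y, φ y • (Δ V) y⟫ =
      (∫ y, ‖(Δ (fun y => φ y • V y)) y‖ ^ 2) -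
        ∫ y, ⟪(Δ (fun y => φ y • V y)) y, (Δ (fun y => φ y • V y)) y - φ y • (Δ V) y⟫ := by
    have i6 : Integrable (fun y => ‖(Δ (fun y => φ y • V y)) y‖ ^ 2)
        (volume : Measure (EuclideanSpace ℝ (Fin 3))) :=
      (hcΔw.norm.pow 2).integrable_of_hasCompactSupport
        (HasCompactSupport.intro hΔws fun y hy => by
          show ‖(Δ (fun y => φ y • V y)) y‖ ^ 2 = 0
          rw [image_eq_zero_of_notMem_tsupport hy, norm_zero, zero_pow two_ne_zero])
    have i51 : Integrable (fun y => ⟪(Δ (fun y => φ y • V y)) y,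
        (Δ (fun y => φ y • V y)) y - φ y • (Δ V) y⟫) (volume : Measure (EuclideanSpace ℝ (Fin 3))) := by
      refine (i5.sub i1).congr (Eventually.of_forall fun y => ?_)
      simp only [Pi.sub_apply, inner_sub_right]
    rw [← integral_sub i6 i51]
    refine integral_congr_ae (Eventually.of_forall fun y => ?_)
    simp only [inner_sub_right, real_inner_self_eq_norm_sq]; ring
  -- (c') the pressure
  have hφ1 : ContDiff ℝ 1 φ := hφ.of_le (by norm_cast)
  have hc : ∫ y, ⟪gradient q y, φ y • (Δ (fun y => φ y • V y)) y⟫ =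
      -∫ y, q y * VectorCalculus.divergence (fun y => φ y • (Δ (fun y => φ y • V y)) y) y :=
    integral_inner_gradient_cutoff_eq hq1 hφ1 hΔw1 hΔws
  rw [hL, ha, hc]
  ring

end Summit.NavierStokesRegularity.NavierStokesRegularity.Theorems.TypeITraceScarL3

end
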